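import Literature.MathematicalPhysics.QuantumFieldTheory.IsingGaugeDualityThree
import Literature.Probability.LatticeModels.GKSHighTemperatureExpansion
import HarnessLib

/-!
# Free-boundary `ℤ₂` lattice gauge theory on a region of `ℤ^d` as a ferromagnetic `±1` spin system
# (GKS form) on its bond variables

`ℤ₂` lattice gauge theory is «a model of statistical mechanics … quite simple to describe: `±1` spins
attached to the edges, probability `∝ exp(β ∑_p σ_p)`, `σ_p` the product of the four edge spins of the
plaquette `p`» (S. Chatterjee, *Wilson loops in Ising lattice gauge theory*, Comm. Math. Phys. 377
(2020), §1.1, (1.1)–(1.3); M. Aizenman, Math. Phys. Anal. Geom. 28 (2025) §9.1, `H = -∑_p ∏_{b∈∂p} A_b`),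
i.e. a ferromagnetic spin system `ν_{Λ;K} ∝ exp{∑ᵢ Kᵢ ω_{Cᵢ}}` in the sense of Friedli–Velenik 2017
§3.8.1 with one interaction term per plaquette, `K_p = β`, `C_p =` the four bonds of `p`. The tree
has this identification on the TORUS (`Z2WilsonLoopGKS.lean`, `wilsonExpectation_z2_eq_gksExpect`);
this file proves it for the FREE-BOUNDARY theory on a finite region `Λ ⊆ ℤ^d` — the measure-theoretic
`zdExpect (znRep 2) β Λ` of `Sweep1.lean`, whose cube limits define the tree's infinite-volume `ℤ₂`
Wilson-loop functions (`znWilsonLoopLimit 2`, `znWilsonPairCov 2`) — by matching the two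
high-temperature expansions:

* the surface representation of free-boundary `ℤ₂` expectations (tree
  `Z2Duality.zdExpect_z2_prod_plaqSpin_eq`: `⟨∏_{p∈S} A_{∂p}⟩_{Λ,β} = ∑_{n ⊆ P, ∂(S∆n) = ∅} t^{|n|} ∕
  ∑_{n ⊆ P, ∂n = ∅} t^{|n|}`, `t = tanh β`, `P` the plaquettes of `Λ`), and
* the high-temperature expansion of `⟨σ_A⟩_{Λ;β}` for the spin system on the bonds `B(Λ) = ⋃_{p∈P} ∂p`
  with the plaquette terms (tree `gksExpect_spinProduct_eq_htRatio_const`).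

Main results (all PROVED, no definitions — the sets are written as `Finset.filter`s —, no named facts):

* §1 bookkeeping: the slots of a genuine plaquette are distinct (`slot_injective_of_ne`), so the
  `ℤ₂`-boundary `∂Q` of the tree (`Z2Duality.bdry`) is the parity of `#{q ∈ Q : e ∈ ∂q}`
  (`bdry_eq_card_filter`), and `Q` is closed iff every bond of `B(Λ)` is covered an even number of
  times (`isClosed_iff_forall_even`);
* §2 **`⟨∏_{p∈S} A_{∂p}⟩_{Λ,β} = ⟨σ_{E_S}⟩_{B(Λ);β}`** for every family `S` of genuine plaquette labels
  with bonds in `B(Λ)`, where `E_S = {b ∈ B(Λ) : #{p ∈ S : b ∈ ∂p} odd}` is the `ℤ₂`-boundary of `S`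
  (`zdExpect_z2_prod_plaqSpin_eq_gksExpect`); in particular for the Wilson loop of a rectangle,
  `W_γ = ∏_{p ∈ sheet} A_{∂p}` (tree `zdWilsonLoop_znRep_two_eq_prod_plaqSpin`);
* §3 consequences by the GKS inequalities of the tree (`gksExpect_spinProduct_nonneg`,
  `gksExpect_mul_gksExpect_le`): **Griffiths I and II for arbitrary products of plaquette variables
  in a free-boundary region** (`zdExpect_z2_prod_plaqSpin_nonneg`, `zdExpect_z2_prod_plaqSpin_mul_ge`),
  `β ≥ 0` — Forsström–Viklund 2025 Prop. 6.3 (i)–(ii) (stated there for loop observables on the torus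
  via currents) for every surface observable and free boundary conditions.

The point of the GKS form is that the whole apparatus of `GKSInequalities.lean` ∕
`IsingTruncatedPairLowerBound.lean` (comparison of couplings, freezing, Ginibre's duplicated system,
finite-energy lower bounds for truncated correlations) becomes available for the free-boundary
`ℤ₂` gauge theory and hence for its infinite-volume Wilson-loop covariances.

HONEST FRAMING (cell `ym-ir`): `ℤ₂` only (abelian, a calibration model); nothing here bears on
`SU(N)`, on `BalabanLadder.IR`, or on the Yang–Mills mass gap (Clay); in the `ym` ladder only the
conditional finite-`𝕋⁴` rung `BalabanLadder.UV` is closed by any route.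

## References

* S. Chatterjee, *Wilson loops in Ising lattice gauge theory*, Comm. Math. Phys. 377 (2020) 307–340,
  §1.1 (1.1)–(1.3). [arXiv181109770]
* M. Aizenman, *Geometric analysis of Ising models, Part III*, Math. Phys. Anal. Geom. 28 (2025),
  arXiv:2509.02850, §9.1–§9.2 (the variables `A_b`, `A_{∂p}`; eq. (48) `∂𝐧`; (LGM_RCR)). [Aizenman2025]
* S. Friedli, Y. Velenik, *Statistical Mechanics of Lattice Systems*, CUP (2017), §3.8.1 Thm. 3.49
  and §3.7.3 eq. (3.44). [FriedliVelenik2017]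
* M. P. Forsström, F. Viklund, arXiv:2502.19942 (2025), Prop. 6.3. [ForsstromViklund2025currents]
-/

noncomputable section

open MeasureTheory Finset Filter
open scoped symmDiff
open Literature.Probability.LatticeModels
open Literature.Barriers.QuantumFields (rootsOfUnityCircle znRep)

namespace Literature.MathematicalPhysics.QuantumFieldTheory

namespace Z2Duality

variable {d : ℕ}

/-! ### §1 Slots, boundaries and parities -/

/-- `y + eᵢ ≠ y` in `ℤ^d`. [folklore] -/
private theorem add_single_one_ne_self (y : Probability.LatticeModels.Site d) (i : Fin d) :
    y + Pi.single i 1 ≠ y := by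
  intro h
  have := congrFun h i
  simp at this

/-- The four slots `(x,i), (x+eᵢ,j), (x+eⱼ,i), (x,j)` of a genuine plaquette label (`i ≠ j`) are
pairwise distinct bonds. [cite: Aizenman2025, §9.1 (∂p consists of four edges)] -/
theorem slot_injective_of_ne {q : Plaq d} (hq : q.2.1 ≠ q.2.2) : Function.Injective (slot q) := by
  intro s t h
  have h1 := congrArg Prod.fst h
  have h2 := congrArg Prod.snd h
  fin_cases s <;> fin_cases t <;>
    simp only [slot, Fin.zero_eta, Fin.mk_one, Fin.reduceFinMk, Matrix.cons_val_zero, Matrix.cons_val_one,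
      Matrix.cons_val] at h1 h2 ⊢ <;>
    first
    | rfl
    | exact absurd h2 hq
    | exact absurd h2.symm hq
    | exact absurd h1 (add_single_one_ne_self _ _)
    | exact absurd h1.symm (add_single_one_ne_self _ _)

/-- For a genuine plaquette label, the slot count at a bond is its membership indicator:
`∑_s 1{slot q s = e} = 1{e ∈ ∂q}` in `ℤ₂`. [cite: Aizenman2025, §9.2 (eq. (48))] -/
theorem sum_slot_indicator_eq {q : Plaq d} (hq : q.2.1 ≠ q.2.2) (e : ZdEdge d) :
    (∑ s : Fin 4, if slot q s = e then (1 : ZMod 2) else 0) = if e ∈ q.bonds then 1 else 0 := by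
  classical
  rw [Finset.sum_boole]
  by_cases he : e ∈ q.bonds
  · obtain ⟨s₀, hs₀⟩ := (mem_bonds_iff_exists_slot q e).1 he
    have hfilter : (Finset.univ.filter fun s : Fin 4 => slot q s = e) = {s₀} := by
      ext s
      simp only [Finset.mem_filter, Finset.mem_univ, true_and, Finset.mem_singleton]
      constructor
      · intro h; exact slot_injective_of_ne hq (h.trans hs₀.symm)
      · rintro rfl; exact hs₀
    rw [hfilter, if_pos he, Finset.card_singleton, Nat.cast_one]
  · have hfilter : (Finset.univ.filter fun s : Fin 4 => slot q s = e) = ∅ := by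
      ext s
      simp only [Finset.mem_filter, Finset.mem_univ, true_and, Finset.notMem_empty, iff_false]
      intro h; exact he ((mem_bonds_iff_exists_slot q e).2 ⟨s, h⟩)
    rw [hfilter, if_neg he, Finset.card_empty, Nat.cast_zero]

/-- **The `ℤ₂`-boundary as a cover parity**: for a family `Q` of genuine plaquette labels,
`∂Q(e) = #{q ∈ Q : e ∈ ∂q} (mod 2)`. [cite: Aizenman2025, §9.2 (eq. (48): ∂𝐧 = {b : ∑_{p ∋ b} n(p) odd})] -/
theorem bdry_eq_card_filter {Q : Finset (Plaq d)} (hQ : ∀ q ∈ Q, q.2.1 ≠ q.2.2) (e : ZdEdge d) :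
    bdry Q e = (#(Q.filter fun q => e ∈ q.bonds) : ZMod 2) := by
  classical
  rw [bdry, Finset.card_filter, Nat.cast_sum]
  refine Finset.sum_congr rfl fun q hq => ?_
  rw [sum_slot_indicator_eq (hQ q hq) e]
  split_ifs <;> simp

/-- **Closed chains = even covers of the bonds**: a family `Q` of genuine plaquette labels whose bonds
lie in a set `B` is closed (`∂Q = ∅`) iff every bond of `B` lies in an even number of the `∂q`,
`q ∈ Q`. [cite: Aizenman2025, §9.2 (eq. (48))] -/
theorem isClosed_iff_forall_even {B : Finset (ZdEdge d)} {Q : Finset (Plaq d)}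
    (hQ : ∀ q ∈ Q, q.2.1 ≠ q.2.2 ∧ q.bonds ⊆ B) :
    IsClosed Q ↔ ∀ x : ↥B, Even #(Q.filter fun q => (x : ZdEdge d) ∈ q.bonds) := by
  classical
  have hQ' : ∀ q ∈ Q, q.2.1 ≠ q.2.2 := fun q hq => (hQ q hq).1
  constructor
  · intro h x
    rw [← ZMod.natCast_eq_zero_iff_even, ← bdry_eq_card_filter hQ']
    exact h x
  · intro h e
    by_cases he : e ∈ B
    · rw [bdry_eq_card_filter hQ', ZMod.natCast_eq_zero_iff_even]
      exact h ⟨e, he⟩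
    · rw [bdry_eq_card_filter hQ']
      have : Q.filter (fun q => e ∈ q.bonds) = ∅ := by
        refine Finset.filter_false_of_mem fun q hq heq => he ((hQ q hq).2 heq)
      rw [this, Finset.card_empty, Nat.cast_zero]

/-- Parity bookkeeping: `#(S ∆ n)_e ≡ #S_e + #n_e (mod 2)`, where `S_e`, `n_e` are the members of
`S`, `n` containing the bond `e` (`∂(S ∆ n) = ∂S + ∂n`). [cite: Aizenman2025, §9.2 (∂ additive mod 2, proof of Thm 9.2 (2))] -/
theorem even_card_symmDiff_filter_iff {S n : Finset (Plaq d)} (hS : ∀ q ∈ S, q.2.1 ≠ q.2.2)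
    (hn : ∀ q ∈ n, q.2.1 ≠ q.2.2) (e : ZdEdge d) :
    Even #((S ∆ n).filter fun q => e ∈ q.bonds) ↔
      Even (#(S.filter fun q => e ∈ q.bonds) + #(n.filter fun q => e ∈ q.bonds)) := by
  classical
  have hSn : ∀ q ∈ S ∆ n, q.2.1 ≠ q.2.2 := fun q hq => by
    rcases Finset.mem_symmDiff.1 hq with h | h
    exacts [hS q h.1, hn q h.1]
  rw [← ZMod.natCast_eq_zero_iff_even, ← ZMod.natCast_eq_zero_iff_even, ← bdry_eq_card_filter hSn,
    Nat.cast_add, ← bdry_eq_card_filter hS, ← bdry_eq_card_filter hn, bdry_symmDiff]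

/-! ### §2 The free-boundary `ℤ₂` gauge theory on `Λ` as the spin system on its bonds -/

/-- **Free-boundary `ℤ₂` lattice gauge theory is the ferromagnetic spin system on its bond variables**
(Chatterjee 2020 §1.1 (1.1)–(1.3); Aizenman 2025 §9.1): for a region `Λ ⊆ ℤ^d` with plaquettes
`P = plaquettesIn Λ` and bonds `B = ⋃_{p∈P} ∂p`, and every family `S` of genuine plaquette labels with
bonds in `B`,
`⟨∏_{p∈S} A_{∂p}⟩_{Λ,β} = ⟨σ_{E_S}⟩_{ν_{B;K}}`, `K_p = β`, `C_p = ∂p` (`p ∈ P`),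
`E_S = {b ∈ B : #{p ∈ S : b ∈ ∂p} odd}` — both sides being the same ratio of high-temperature ∕
random-surface sums (tree `zdExpect_z2_prod_plaqSpin_eq` and `gksExpect_spinProduct_eq_htRatio_const`).
[cite: Aizenman2025, §9.1–§9.2 (H_LGM and (LGM_RCR)); FriedliVelenik2017 §3.8.1] -/
theorem zdExpect_z2_prod_plaqSpin_eq_gksExpect (β : ℝ) (Λ : Finset (Probability.LatticeModels.Site d))
    {S : Finset (Plaq d)}
    (hS : ∀ q ∈ S, q.2.1 ≠ q.2.2 ∧ q.bonds ⊆ (plaquettesIn Λ).biUnion Plaq.bonds) :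
    zdExpect (znRep 2) β Λ (fun U => ∏ p ∈ S, plaqSpin U p) =
      gksExpect (plaquettesIn Λ) (fun _ => β)
        (fun q : Plaq d => inVol ((plaquettesIn Λ).biUnion Plaq.bonds) q.bonds)
        (spinProduct (univ.filter fun x : ↥((plaquettesIn Λ).biUnion Plaq.bonds) =>
          Odd #(S.filter fun q => (x : ZdEdge d) ∈ q.bonds))) := by
  classical
  rw [zdExpect_z2_prod_plaqSpin_eq, gksExpect_spinProduct_eq_htRatio_const]
  set P : Finset (Plaq d) := plaquettesIn Λ with hP
  set B : Finset (ZdEdge d) := P.biUnion Plaq.bonds with hB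
  have hPgen : ∀ q ∈ P, q.2.1 ≠ q.2.2 ∧ Plaq.bonds q ⊆ B := fun q hq =>
    ⟨(Plaq.mem_plaquettesIn.1 hq).2.1.ne, Finset.subset_biUnion_of_mem Plaq.bonds hq⟩
  have hsub : ∀ n ∈ P.powerset, ∀ q ∈ n, q.2.1 ≠ q.2.2 ∧ Plaq.bonds q ⊆ B := fun n hn q hq =>
    hPgen q (Finset.mem_powerset.1 hn hq)
  -- the indicator sums are cover counts
  have hcount : ∀ (n : Finset (Plaq d)) (x : ↥B),
      (∑ q ∈ n, if x ∈ inVol B (Plaq.bonds q) then 1 else 0) = #(n.filter fun q => (x : ZdEdge d) ∈ q.bonds) := by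
    intro n x
    rw [Finset.card_filter]
    exact Finset.sum_congr rfl fun q _ => by simp only [mem_inVol]
  -- numerator predicates agree on `P.powerset`
  have hnum : ∀ n ∈ P.powerset,
      (∀ x : ↥B, Even ((if x ∈ univ.filter (fun x : ↥B => Odd #(S.filter fun q => (x : ZdEdge d) ∈ q.bonds))
          then 1 else 0) + ∑ q ∈ n, if x ∈ inVol B (Plaq.bonds q) then 1 else 0)) ↔ IsClosed (S ∆ n) := by
    intro n hn
    have hn' := hsub n hn
    have hSn : ∀ q ∈ S ∆ n, q.2.1 ≠ q.2.2 ∧ q.bonds ⊆ B := fun q hq => by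
      rcases Finset.mem_symmDiff.1 hq with h | h
      exacts [hS q h.1, hn' q h.1]
    rw [isClosed_iff_forall_even hSn]
    refine forall_congr' fun x => ?_
    have hc : Even (if x ∈ univ.filter (fun x : ↥B => Odd #(S.filter fun q => (x : ZdEdge d) ∈ q.bonds))
        then (1 : ℕ) else 0) ↔ Even #(S.filter fun q => (x : ZdEdge d) ∈ q.bonds) := by
      by_cases hx : Odd #(S.filter fun q => (x : ZdEdge d) ∈ q.bonds)
      · have hxA : x ∈ univ.filter (fun x : ↥B => Odd #(S.filter fun q => (x : ZdEdge d) ∈ q.bonds)) :=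
          Finset.mem_filter.2 ⟨Finset.mem_univ _, hx⟩
        rw [if_pos hxA]
        exact ⟨fun h => absurd h (by decide), fun h => absurd hx (Nat.not_odd_iff_even.2 h)⟩
      · have hxA : x ∉ univ.filter (fun x : ↥B => Odd #(S.filter fun q => (x : ZdEdge d) ∈ q.bonds)) :=
          fun h => hx (Finset.mem_filter.1 h).2
        rw [if_neg hxA]
        exact ⟨fun _ => Nat.not_odd_iff_even.1 hx, fun _ => (by decide)⟩
    rw [Nat.even_add, hc, hcount n x, ← Nat.even_add,
      even_card_symmDiff_filter_iff (fun q hq => (hS q hq).1) (fun q hq => (hn' q hq).1)]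
  -- denominator predicates agree on `P.powerset`
  have hden : ∀ n ∈ P.powerset,
      (∀ x : ↥B, Even (∑ q ∈ n, if x ∈ inVol B (Plaq.bonds q) then 1 else 0)) ↔ IsClosed n := by
    intro n hn
    rw [isClosed_iff_forall_even (hsub n hn)]
    refine forall_congr' fun x => ?_
    rw [hcount n x]
  congr 1
  · refine Finset.sum_congr ?_ fun _ _ => rfl
    ext n
    rw [Finset.mem_filter, Finset.mem_filter]
    exact ⟨fun h => ⟨h.1, (hnum n h.1).2 h.2⟩, fun h => ⟨h.1, (hnum n h.1).1 h.2⟩⟩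
  · refine Finset.sum_congr ?_ fun _ _ => rfl
    ext n
    rw [Finset.mem_filter, Finset.mem_filter]
    exact ⟨fun h => ⟨h.1, (hden n h.1).2 h.2⟩, fun h => ⟨h.1, (hden n h.1).1 h.2⟩⟩

/-- The Wilson loop of a rectangle (`i ≠ j`) as a spin product of the bond system: its sheet
`rectPlaqs x i j R T` consists of genuine labels, so `⟨W_{R×T}⟩_{Λ,β} = ⟨σ_{E_{sheet}}⟩_{ν_{B;β}}` as
soon as the sheet's bonds lie in `B(Λ)`. [cite: Aizenman2025, §9.2 (W_γ = ∏_{p ∈ 𝒮} A_{∂p})] -/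
theorem zdExpect_z2_wilsonLoop_eq_gksExpect (β : ℝ) (Λ : Finset (Probability.LatticeModels.Site d))
    (x : Probability.LatticeModels.Site d) {i j : Fin d} (hij : i ≠ j) (R T : ℕ)
    (hsheet : ∀ q ∈ rectPlaqs x i j R T, q.bonds ⊆ (plaquettesIn Λ).biUnion Plaq.bonds) :
    zdExpect (znRep 2) β Λ (zdWilsonLoop (znRep 2) x i j R T) =
      gksExpect (plaquettesIn Λ) (fun _ => β)
        (fun q : Plaq d => inVol ((plaquettesIn Λ).biUnion Plaq.bonds) q.bonds)
        (spinProduct (univ.filter fun e : ↥((plaquettesIn Λ).biUnion Plaq.bonds) =>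
          Odd #((rectPlaqs x i j R T).filter fun q => (e : ZdEdge d) ∈ q.bonds))) := by
  have hfun : zdWilsonLoop (znRep 2) x i j R T =
      fun U => ∏ p ∈ rectPlaqs x i j R T, plaqSpin U p :=
    funext fun U => zdWilsonLoop_znRep_two_eq_prod_plaqSpin x hij R T U
  rw [hfun]
  refine zdExpect_z2_prod_plaqSpin_eq_gksExpect β Λ fun q hq => ⟨?_, hsheet q hq⟩
  obtain ⟨ts, -, rfl⟩ := Finset.mem_image.1 hq
  exact hij

/-! ### §3 Griffiths' inequalities for surface observables of the free-boundary `ℤ₂` theory -/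

/-- The odd-cover set is additive under symmetric difference of plaquette families:
`E_{S ∆ S'} = E_S ∆ E_{S'}`. [cite: Aizenman2025, §9.2 (∂ is additive mod 2)] -/
theorem oddCover_plaq_symmDiff {B : Finset (ZdEdge d)} {S S' : Finset (Plaq d)}
    (hS : ∀ q ∈ S, q.2.1 ≠ q.2.2) (hS' : ∀ q ∈ S', q.2.1 ≠ q.2.2) :
    (univ.filter fun x : ↥B => Odd #((S ∆ S').filter fun q => (x : ZdEdge d) ∈ q.bonds)) =
      (univ.filter fun x : ↥B => Odd #(S.filter fun q => (x : ZdEdge d) ∈ q.bonds)) ∆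
        (univ.filter fun x : ↥B => Odd #(S'.filter fun q => (x : ZdEdge d) ∈ q.bonds)) := by
  classical
  have hSS' : ∀ q ∈ S ∆ S', q.2.1 ≠ q.2.2 := fun q hq => by
    rcases Finset.mem_symmDiff.1 hq with h | h
    exacts [hS q h.1, hS' q h.1]
  ext x
  simp only [Finset.mem_filter, Finset.mem_univ, true_and, Finset.mem_symmDiff]
  rw [← ZMod.natCast_eq_one_iff_odd, ← ZMod.natCast_eq_one_iff_odd, ← ZMod.natCast_eq_one_iff_odd,
    ← bdry_eq_card_filter hSS', ← bdry_eq_card_filter hS, ← bdry_eq_card_filter hS', bdry_symmDiff]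
  have h01 : ∀ z : ZMod 2, z = 0 ∨ z = 1 := by decide
  rcases h01 (bdry S (x : ZdEdge d)) with h | h <;> rcases h01 (bdry S' (x : ZdEdge d)) with h' | h' <;>
    simp [h, h']

/-- **Griffiths I for surface observables**: `⟨∏_{p∈S} A_{∂p}⟩_{Λ,β} ≥ 0` for `β ≥ 0` and every family
`S` of genuine plaquette labels with bonds in `B(Λ)` (GKS I for the bond system).
[cite: ForsstromViklund2025currents, Prop. 6.3 (i); FriedliVelenik2017 Thm. 3.49 (3.54)] -/
theorem zdExpect_z2_prod_plaqSpin_nonneg {β : ℝ} (hβ : 0 ≤ β) (Λ : Finset (Probability.LatticeModels.Site d))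
    {S : Finset (Plaq d)} (hS : ∀ q ∈ S, q.2.1 ≠ q.2.2 ∧ q.bonds ⊆ (plaquettesIn Λ).biUnion Plaq.bonds) :
    0 ≤ zdExpect (znRep 2) β Λ (fun U => ∏ p ∈ S, plaqSpin U p) := by
  classical
  rw [zdExpect_z2_prod_plaqSpin_eq_gksExpect β Λ hS]
  exact gksExpect_spinProduct_nonneg _ _ _ (fun _ _ => hβ) _

/-- **Griffiths II for surface observables of the free-boundary `ℤ₂` gauge theory**: for `β ≥ 0` and
any two families `S, S'` of genuine plaquette labels with bonds in `B(Λ)`,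
`⟨(∏_{p∈S} A_{∂p})(∏_{p∈S'} A_{∂p})⟩_{Λ,β} ≥ ⟨∏_{p∈S} A_{∂p}⟩_{Λ,β} ⟨∏_{p∈S'} A_{∂p}⟩_{Λ,β}` — in
particular the product of any two Wilson loops is positively correlated in every free-boundary region
(GKS II for the bond system, F–V Thm. 3.49 (3.55)). [cite: ForsstromViklund2025currents, Prop. 6.3 (ii); FriedliVelenik2017 Thm. 3.49 (3.55)] -/
theorem zdExpect_z2_prod_plaqSpin_mul_ge {β : ℝ} (hβ : 0 ≤ β) (Λ : Finset (Probability.LatticeModels.Site d))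
    {S S' : Finset (Plaq d)} (hS : ∀ q ∈ S, q.2.1 ≠ q.2.2 ∧ q.bonds ⊆ (plaquettesIn Λ).biUnion Plaq.bonds)
    (hS' : ∀ q ∈ S', q.2.1 ≠ q.2.2 ∧ q.bonds ⊆ (plaquettesIn Λ).biUnion Plaq.bonds) :
    zdExpect (znRep 2) β Λ (fun U => ∏ p ∈ S, plaqSpin U p) *
        zdExpect (znRep 2) β Λ (fun U => ∏ p ∈ S', plaqSpin U p) ≤
      zdExpect (znRep 2) β Λ (fun U => (∏ p ∈ S, plaqSpin U p) * ∏ p ∈ S', plaqSpin U p) := by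
  classical
  have hSS' : ∀ q ∈ S ∆ S', q.2.1 ≠ q.2.2 ∧ q.bonds ⊆ (plaquettesIn Λ).biUnion Plaq.bonds := fun q hq => by
    rcases Finset.mem_symmDiff.1 hq with h | h
    exacts [hS q h.1, hS' q h.1]
  simp_rw [prod_plaqSpin_mul_prod_plaqSpin]
  rw [zdExpect_z2_prod_plaqSpin_eq_gksExpect β Λ hS, zdExpect_z2_prod_plaqSpin_eq_gksExpect β Λ hS',
    zdExpect_z2_prod_plaqSpin_eq_gksExpect β Λ hSS',
    oddCover_plaq_symmDiff (fun q hq => (hS q hq).1) (fun q hq => (hS' q hq).1)]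
  exact gksExpect_mul_gksExpect_le _ _ _ (fun _ _ => hβ) _ _

end Z2Duality

end Literature.MathematicalPhysics.QuantumFieldTheory
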